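import Mathlib

/-!
# `Balaban1983to89.B4Eq19LatticeOperators` — T. Bałaban, *Propagators and renormalization transformations for lattice gauge theories. II*,
# Commun. Math. Phys. **96** (1984) 223–250 [Balaban1984PropagatorsII] (1.9) p. 226 (Hölder regularity of the flat lattice propagators, the input of
# [Balaban1985BackgroundPropagators] Thm 3.1 (3.43) p. 398): **THE UNIT LATTICE `ℤ^d` — forward differences, the massive lattice operator `−Δ + κ`,
# the lattice divergence, boxes, and SUMMATION BY PARTS** — the vocabulary of the interior-regularity files `B4Eq19Lattice*` (Caccioppoli, Dirichlet
# replacement, mixed Sobolev embedding, harmonic decay, Campanato iteration, Poincaré–Morrey, interior Hölder), by which the LOCAL η-scale `C^β` estimate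
# `Hloc` of `B9Eq343FlatWindowLetterOfLocalHolder` is proved on the universal cover of the torus `TSite d (towerP L m (n+1))`.

statement-level skeleton of published theorems with citation tags; proofs where landed; nothing here is a claim about the Yang–Mills mass gap

CITATION HEADER (lean-in-tree rule).  Audit cell `pub-balaban`, sub-cell `t4`, BINDER row NE9; filed by NE9 crux-team LEAF PROVER 01
(`b2b-balaban-t4-ne9-formalise-leaf-01`, gen 94; bears_on: R4/N22).  The CONTENT is [folklore] lattice calculus (the discrete analogue of
[Giaquinta1984] Ch. III §1–2's set-up); [Balaban1984PropagatorsII] (1.9) is the printed statement these files serve, nothing of it is asserted here.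

WHAT IS DEFINED (reviewed definitions, all elementary and REAL):
* `Zd d = Fin d → ℤ`; `unitVec μ = e_μ`; `fdiff μ u y = u(y + e_μ) − u(y)` (forward difference); `lop κ u y = Σ_μ (2u(y) − u(y+e_μ) − u(y−e_μ)) + κ·u(y)`
  (the massive lattice operator `−Δ + κ`); `dvg g y = Σ_μ (g(y − e_μ, μ) − g(y, μ))` (the lattice divergence `∂*g` of a bond function `g : Zd d → Fin d → ℝ`,
  bond `(y, μ) = ⟨y, y + e_μ⟩`); `box z r` (the sup-norm ball `{y : |y_i − z_i| ≤ r ∀ i}`, a `Finset`); `gradSq u Q = Σ_{y ∈ Q} Σ_μ (fdiff μ u y)²`.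
WHAT IS PROVED (sorry-free): membership ∕ monotonicity ∕ cardinality of boxes (`mem_box`, `box_mono`, `box_subset_box`, `card_box`), translation of box sums
(`sum_box_add_right`), sums of functions supported in a box (`sum_eq_sum_box_of_support`), the ONE-COORDINATE SPLITTING of a `piFinset` sum
(`sum_piFinset_eq_sum_update`), the product rule `fdiff_mul`, the commutation `lop κ (fdiff ν u) = fdiff ν (lop κ u)`, and SUMMATION BY PARTS on `ℤ^d` for a
test function supported in the interior of a box: `Σ φ·(−Δ+κ)u = Σ_μ Σ ∂_μφ·∂_μu + κ Σ φu` (`sum_mul_lop`) and `Σ φ·∂*g = Σ_μ Σ ∂_μφ·g_μ` (`sum_mul_dvg`).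
HONEST SCOPE.  Definitions + [folklore] identities; no estimate; NOT summit progress (cell pub-balaban: NE9 NOT PRINTED ∕ NOT PROVED; spine PROVED 0∕9;
finite T⁴ — NOT infinite volume, NOT mass gap, NOT BetaPertH, NOT Clay).  NEW file importing Mathlib only.  Net new unproved facts: 0.
-/

noncomputable section

open scoped BigOperators
open Finset

namespace Literature.MathematicalPhysics.QuantumFieldTheory.Balaban1983to89.B4Eq19LatticeOperators

/-! ## §1 The lattice `ℤ^d`, unit vectors, boxes -/

/-- The unit lattice `ℤ^d` (the universal cover of every discrete torus `Π_i ℤ∕P_iℤ`). [folklore]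
[cite: Balaban1984PropagatorsII, (1.9) p.226] -/
abbrev Zd (d : ℕ) : Type := Fin d → ℤ

variable {d : ℕ}

/-- The unit vector `e_μ ∈ ℤ^d`. [folklore] [cite: Balaban1984PropagatorsII, (1.9) p.226] -/
def unitVec (μ : Fin d) : Zd d := Pi.single μ 1

/-- `(e_μ)_μ = 1`. [folklore] [cite: Balaban1984PropagatorsII, (1.9) p.226] -/
@[simp] theorem unitVec_apply_self (μ : Fin d) : unitVec μ μ = (1 : ℤ) := by
  simp [unitVec]

/-- `(e_μ)_i = 0` for `i ≠ μ`. [folklore] [cite: Balaban1984PropagatorsII, (1.9) p.226] -/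
@[simp] theorem unitVec_apply_ne {μ i : Fin d} (h : i ≠ μ) : unitVec μ i = (0 : ℤ) := by
  simp [unitVec, h]

/-- `|(e_μ)_i| ≤ 1`. [folklore] [cite: Balaban1984PropagatorsII, (1.9) p.226] -/
theorem abs_unitVec_apply_le (μ i : Fin d) : |unitVec μ i| ≤ (1 : ℤ) := by
  by_cases h : i = μ
  · subst h; simp
  · simp [unitVec_apply_ne h]

/-- **The box** `Q_r(z) = {y ∈ ℤ^d : |y_i − z_i| ≤ r for all i}` — the closed sup-norm ball of radius `r` (empty for `r < 0`).
[folklore] [cite: Giaquinta1984, Ch. III §1 p.64] -/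
def box (z : Zd d) (r : ℤ) : Finset (Zd d) := Fintype.piFinset fun i => Finset.Icc (z i - r) (z i + r)

/-- Membership in a box. [folklore] [cite: Giaquinta1984, Ch. III §1 p.64] -/
theorem mem_box {z : Zd d} {r : ℤ} {y : Zd d} : y ∈ box z r ↔ ∀ i, |y i - z i| ≤ r := by
  simp only [box, Fintype.mem_piFinset, Finset.mem_Icc, abs_sub_le_iff]
  refine forall_congr' fun i => ?_
  constructor
  · rintro ⟨h1, h2⟩; constructor <;> linarith
  · rintro ⟨h1, h2⟩; constructor <;> linarith

/-- Boxes increase with the radius. [folklore] [cite: Giaquinta1984, Ch. III §1 p.64] -/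
theorem box_mono (z : Zd d) {r r' : ℤ} (h : r ≤ r') : box z r ⊆ box z r' := by
  intro y hy
  rw [mem_box] at hy ⊢
  exact fun i => (hy i).trans h

/-- A box around a nearby centre: `|z′ − z|_∞ + r′ ≤ r ⟹ Q_{r′}(z′) ⊆ Q_r(z)`. [folklore] [cite: Giaquinta1984, Ch. III §1 p.64] -/
theorem box_subset_box {z z' : Zd d} {r r' : ℤ} (h : ∀ i, |z' i - z i| + r' ≤ r) : box z' r' ⊆ box z r := by
  intro y hy
  rw [mem_box] at hy ⊢
  intro i
  calc |y i - z i| = |(y i - z' i) + (z' i - z i)| := by ring_nf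
    _ ≤ |y i - z' i| + |z' i - z i| := abs_add_le _ _
    _ ≤ r' + |z' i - z i| := by linarith [hy i]
    _ ≤ r := by linarith [h i]

/-- The centre lies in its box (`r ≥ 0`). [folklore] [cite: Giaquinta1984, Ch. III §1 p.64] -/
theorem self_mem_box (z : Zd d) {r : ℤ} (hr : 0 ≤ r) : z ∈ box z r := by
  rw [mem_box]; intro i; simpa using hr

/-- Membership of a box is symmetric in centre and point. [folklore] [cite: Giaquinta1984, Ch. III §1 p.64] -/
theorem mem_box_comm {z y : Zd d} {r : ℤ} : y ∈ box z r ↔ z ∈ box y r := by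
  rw [mem_box, mem_box]
  refine forall_congr' fun i => ?_
  rw [abs_sub_comm]

/-- A unit step leaves a box of radius `r` inside the box of radius `r + 1`. [folklore] [cite: Giaquinta1984, Ch. III §1 p.64] -/
theorem add_unitVec_mem_box {z y : Zd d} {r : ℤ} (hy : y ∈ box z r) (μ : Fin d) : y + unitVec μ ∈ box z (r + 1) := by
  rw [mem_box] at hy ⊢
  intro i
  calc |(y + unitVec μ) i - z i| = |(y i - z i) + unitVec μ i| := by simp only [Pi.add_apply]; ring_nf
    _ ≤ |y i - z i| + |unitVec μ i| := abs_add_le _ _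
    _ ≤ r + 1 := add_le_add (hy i) (abs_unitVec_apply_le μ i)

/-- A backward unit step leaves a box of radius `r` inside the box of radius `r + 1`. [folklore] [cite: Giaquinta1984, Ch. III §1 p.64] -/
theorem sub_unitVec_mem_box {z y : Zd d} {r : ℤ} (hy : y ∈ box z r) (μ : Fin d) : y - unitVec μ ∈ box z (r + 1) := by
  rw [mem_box] at hy ⊢
  intro i
  calc |(y - unitVec μ) i - z i| = |(y i - z i) + (-unitVec μ i)| := by simp only [Pi.sub_apply]; ring_nf
    _ ≤ |y i - z i| + |-unitVec μ i| := abs_add_le _ _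
    _ ≤ r + 1 := by rw [abs_neg]; exact add_le_add (hy i) (abs_unitVec_apply_le μ i)

/-- If `y ∉ Q_{r+1}(z)` then `y ± e_μ ∉ Q_r(z)`. [folklore] [cite: Giaquinta1984, Ch. III §1 p.64] -/
theorem add_unitVec_not_mem_box {z y : Zd d} {r : ℤ} (hy : y ∉ box z (r + 1)) (μ : Fin d) : y + unitVec μ ∉ box z r := by
  intro h
  have := sub_unitVec_mem_box h μ
  rw [add_sub_cancel_right] at this
  exact hy this

/-- If `y ∉ Q_{r+1}(z)` then `y − e_μ ∉ Q_r(z)`. [folklore] [cite: Giaquinta1984, Ch. III §1 p.64] -/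
theorem sub_unitVec_not_mem_box {z y : Zd d} {r : ℤ} (hy : y ∉ box z (r + 1)) (μ : Fin d) : y - unitVec μ ∉ box z r := by
  intro h
  have := add_unitVec_mem_box h μ
  rw [sub_add_cancel] at this
  exact hy this

/-- **Cardinality of a box**: `#Q_r(z) = (2r + 1)^d` for `r ≥ 0`. [folklore] [cite: Giaquinta1984, Ch. III §1 p.64] -/
theorem card_box (z : Zd d) {r : ℤ} (hr : 0 ≤ r) : ((box z r).card : ℝ) = ((2 * r + 1 : ℤ) : ℝ) ^ d := by
  have h : (box z r).card = (2 * r + 1).toNat ^ d := by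
    rw [box, Fintype.card_piFinset]
    have h1 : ∀ i, (Finset.Icc (z i - r) (z i + r)).card = (2 * r + 1).toNat := fun i => by
      rw [Int.card_Icc]; congr 1; ring
    simp only [h1, Finset.prod_const, Finset.card_univ, Fintype.card_fin]
  rw [h, Nat.cast_pow]
  congr 1
  have h2 : (0 : ℤ) ≤ 2 * r + 1 := by linarith
  rw [← Int.cast_natCast, Int.toNat_of_nonneg h2]

/-- The cardinality of a box is at least `1` for `r ≥ 0`. [folklore] [cite: Giaquinta1984, Ch. III §1 p.64] -/
theorem one_le_card_box (z : Zd d) {r : ℤ} (hr : 0 ≤ r) : (1 : ℝ) ≤ (box z r).card := by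
  have : (box z r).Nonempty := ⟨z, self_mem_box z hr⟩
  exact_mod_cast Finset.Nonempty.card_pos this

/-! ## §2 Sums over boxes: translation, support, one-coordinate splitting -/

/-- **Translation of a box sum**: `Σ_{y ∈ Q_r(z)} F(y + v) = Σ_{y ∈ Q_r(z + v)} F(y)`. [folklore] [cite: Giaquinta1984, Ch. III §1 p.64] -/
theorem sum_box_add_right {α : Type*} [AddCommMonoid α] (F : Zd d → α) (z v : Zd d) (r : ℤ) :
    ∑ y ∈ box z r, F (y + v) = ∑ y ∈ box (z + v) r, F y := by
  refine Finset.sum_nbij' (fun y => y + v) (fun y => y - v) ?_ ?_ ?_ ?_ ?_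
  · intro y hy
    rw [mem_box] at hy ⊢
    intro i; simpa using hy i
  · intro y hy
    rw [mem_box] at hy ⊢
    intro i
    have := hy i
    simp only [Pi.sub_apply, Pi.add_apply] at this ⊢
    calc |y i - v i - z i| = |y i - (z i + v i)| := by ring_nf
      _ ≤ r := this
  · intro y _; simp
  · intro y _; simp
  · intro y _; rfl

/-- A function vanishing off a box sums over any larger finset to its box sum. [folklore] [cite: Giaquinta1984, Ch. III §1 p.64] -/
theorem sum_eq_sum_box_of_support {α : Type*} [AddCommMonoid α] {F : Zd d → α} {z : Zd d} {r : ℤ}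
    (hF : ∀ y ∉ box z r, F y = 0) {T : Finset (Zd d)} (hT : box z r ⊆ T) : ∑ y ∈ T, F y = ∑ y ∈ box z r, F y :=
  (Finset.sum_subset hT fun y _ hy => hF y hy).symm

/-- **Shift invariance of the total sum**: if `F` vanishes off `Q_{R−1}(z)`, then `Σ_{y ∈ Q_R(z)} F(y + e_μ) = Σ_{y ∈ Q_R(z)} F(y)` and likewise for
`y − e_μ`. [folklore] [cite: Giaquinta1984, Ch. III §1 p.64] -/
theorem sum_box_shift_of_support {α : Type*} [AddCommMonoid α] {F : Zd d → α} {z : Zd d} {R : ℤ}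
    (hF : ∀ y ∉ box z (R - 1), F y = 0) (v : Zd d) (hv : ∀ i, |v i| ≤ 1) :
    ∑ y ∈ box z R, F (y + v) = ∑ y ∈ box z R, F y := by
  rw [sum_box_add_right]
  have h1 : box z (R - 1) ⊆ box (z + v) R := box_subset_box fun i => by
    simp only [Pi.add_apply]
    calc |z i - (z i + v i)| + (R - 1) = |v i| + (R - 1) := by
          rw [show z i - (z i + v i) = -v i by ring, abs_neg]
      _ ≤ 1 + (R - 1) := by linarith [hv i]
      _ = R := by ring
  have h2 : box z (R - 1) ⊆ box z R := box_mono z (by linarith)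
  rw [sum_eq_sum_box_of_support hF h1, sum_eq_sum_box_of_support hF h2]

/-- **One-coordinate splitting of a product-set sum**: a sum over `piFinset δ` is the sum over the `j`-th coordinate `s ∈ δ j` of the sums over the slice
`piFinset (δ with δ j := {a})` of the function at the point updated to `y_j := s` (Fubini in one coordinate). [folklore]
[cite: Giaquinta1984, Ch. III §1 p.64] -/
theorem sum_piFinset_eq_sum_update {α : Type*} [AddCommMonoid α] (δ : Fin d → Finset ℤ) (j : Fin d) (a : ℤ) (F : Zd d → α) :
    ∑ y ∈ Fintype.piFinset δ, F y =
      ∑ s ∈ δ j, ∑ y ∈ Fintype.piFinset (Function.update δ j {a}), F (Function.update y j s) := by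
  classical
  rw [← Finset.sum_product (s := δ j) (t := Fintype.piFinset (Function.update δ j {a}))
    (f := fun p : ℤ × Zd d => F (Function.update p.2 j p.1))]
  symm
  refine Finset.sum_nbij' (fun p : ℤ × Zd d => Function.update p.2 j p.1) (fun y => (y j, Function.update y j a)) ?_ ?_ ?_ ?_ ?_
  · rintro ⟨s, y⟩ hp
    rw [Finset.mem_product] at hp
    obtain ⟨hs, hy⟩ := hp
    rw [Fintype.mem_piFinset] at hy ⊢
    intro i
    by_cases hi : i = j
    · subst hi; simpa using hs
    · rw [Function.update_of_ne hi]
      have := hy i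
      rwa [Function.update_of_ne hi] at this
  · intro y hy
    rw [Fintype.mem_piFinset] at hy
    rw [Finset.mem_product]
    refine ⟨hy j, ?_⟩
    show Function.update y j a ∈ Fintype.piFinset (Function.update δ j {a})
    rw [Fintype.mem_piFinset]
    intro i
    by_cases hi : i = j
    · subst hi; simp
    · rw [Function.update_of_ne hi, Function.update_of_ne hi]; exact hy i
  · rintro ⟨s, y⟩ hp
    rw [Finset.mem_product] at hp
    obtain ⟨_, hy⟩ := hp
    rw [Fintype.mem_piFinset] at hy
    have hyj : y j = a := by simpa using hy j
    simp only [Function.update_self, Function.update_idem, Prod.mk.injEq, true_and]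
    rw [← hyj, Function.update_eq_self]
  · intro y _
    simp only [Function.update_idem, Function.update_eq_self]
  · intro p _; rfl

/-- The box as a `piFinset` slice: the `j`-slice of `Q_r(z)` through `y_j = a`. [folklore] [cite: Giaquinta1984, Ch. III §1 p.64] -/
theorem sum_box_eq_sum_update {α : Type*} [AddCommMonoid α] (z : Zd d) (r : ℤ) (j : Fin d) (a : ℤ) (F : Zd d → α) :
    ∑ y ∈ box z r, F y = ∑ s ∈ Finset.Icc (z j - r) (z j + r),
      ∑ y ∈ Fintype.piFinset (Function.update (fun i => Finset.Icc (z i - r) (z i + r)) j {a}), F (Function.update y j s) :=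
  sum_piFinset_eq_sum_update _ j a F

/-! ## §3 Forward differences, the operator `−Δ + κ`, the divergence -/

/-- **The forward difference** `∂_μ u(y) = u(y + e_μ) − u(y)`. [folklore] [cite: Balaban1984PropagatorsII, (1.9) p.226] -/
def fdiff (μ : Fin d) (u : Zd d → ℝ) (y : Zd d) : ℝ := u (y + unitVec μ) - u y

/-- **The massive lattice operator** `((−Δ + κ)u)(y) = Σ_μ (2u(y) − u(y + e_μ) − u(y − e_μ)) + κ·u(y)` on `ℤ^d` (unit lattice; [B4] (1.3)'s `−Δ^η` rescaled
to lattice units, flat `U = 1`). [folklore] [cite: Balaban1984PropagatorsII, (1.3) p.225, (1.9) p.226] -/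
def lop (κ : ℝ) (u : Zd d → ℝ) (y : Zd d) : ℝ := (∑ μ, (2 * u y - u (y + unitVec μ) - u (y - unitVec μ))) + κ * u y

/-- **The lattice divergence** `(∂*g)(y) = Σ_μ (g(y − e_μ, μ) − g(y, μ))` of a bond function (`g(y, μ)` sits on the bond `⟨y, y + e_μ⟩`; this is the flat
adjoint derivative `D*` of [B9] (3.8) in lattice units). [folklore] [cite: Balaban1985BackgroundPropagators, (3.8) p.392] -/
def dvg (g : Zd d → Fin d → ℝ) (y : Zd d) : ℝ := ∑ μ, (g (y - unitVec μ) μ - g y μ)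

/-- **The gradient energy on a finset**: `Σ_{y ∈ Q} Σ_μ (∂_μ u(y))²`. [folklore] [cite: Giaquinta1984, Ch. III §2 p.76] -/
def gradSq (u : Zd d → ℝ) (Q : Finset (Zd d)) : ℝ := ∑ y ∈ Q, ∑ μ, fdiff μ u y ^ 2

/-- Unfolding `fdiff`. [folklore] [cite: Balaban1984PropagatorsII, (1.9) p.226] -/
theorem fdiff_apply (μ : Fin d) (u : Zd d → ℝ) (y : Zd d) : fdiff μ u y = u (y + unitVec μ) - u y := rfl

/-- Unfolding `lop`. [folklore] [cite: Balaban1984PropagatorsII, (1.3) p.225] -/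
theorem lop_apply (κ : ℝ) (u : Zd d → ℝ) (y : Zd d) :
    lop κ u y = (∑ μ, (2 * u y - u (y + unitVec μ) - u (y - unitVec μ))) + κ * u y := rfl

/-- Unfolding `dvg`. [folklore] [cite: Balaban1985BackgroundPropagators, (3.8) p.392] -/
theorem dvg_apply (g : Zd d → Fin d → ℝ) (y : Zd d) : dvg g y = ∑ μ, (g (y - unitVec μ) μ - g y μ) := rfl

/-- Unfolding `gradSq`. [folklore] [cite: Giaquinta1984, Ch. III §2 p.76] -/
theorem gradSq_def (u : Zd d → ℝ) (Q : Finset (Zd d)) : gradSq u Q = ∑ y ∈ Q, ∑ μ, fdiff μ u y ^ 2 := rfl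

/-- `gradSq ≥ 0`. [folklore] [cite: Giaquinta1984, Ch. III §2 p.76] -/
theorem gradSq_nonneg (u : Zd d → ℝ) (Q : Finset (Zd d)) : 0 ≤ gradSq u Q :=
  Finset.sum_nonneg fun _ _ => Finset.sum_nonneg fun _ _ => sq_nonneg _

/-- `gradSq` is monotone in the finset. [folklore] [cite: Giaquinta1984, Ch. III §2 p.76] -/
theorem gradSq_mono (u : Zd d → ℝ) {Q Q' : Finset (Zd d)} (h : Q ⊆ Q') : gradSq u Q ≤ gradSq u Q' :=
  Finset.sum_le_sum_of_subset_of_nonneg h fun _ _ _ => Finset.sum_nonneg fun _ _ => sq_nonneg _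

/-- `fdiff` is linear: differences. [folklore] [cite: Balaban1984PropagatorsII, (1.9) p.226] -/
theorem fdiff_sub (μ : Fin d) (u v : Zd d → ℝ) (y : Zd d) : fdiff μ (fun x => u x - v x) y = fdiff μ u y - fdiff μ v y := by
  simp only [fdiff]; ring

/-- `fdiff` is linear: sums. [folklore] [cite: Balaban1984PropagatorsII, (1.9) p.226] -/
theorem fdiff_add (μ : Fin d) (u v : Zd d → ℝ) (y : Zd d) : fdiff μ (fun x => u x + v x) y = fdiff μ u y + fdiff μ v y := by
  simp only [fdiff]; ring

/-- `fdiff` is linear: scalars. [folklore] [cite: Balaban1984PropagatorsII, (1.9) p.226] -/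
theorem fdiff_const_mul (μ : Fin d) (c : ℝ) (u : Zd d → ℝ) (y : Zd d) : fdiff μ (fun x => c * u x) y = c * fdiff μ u y := by
  simp only [fdiff]; ring

/-- **The product rule** `∂_μ(φu)(y) = φ(y + e_μ)·∂_μu(y) + ∂_μφ(y)·u(y)`. [folklore] [cite: Giaquinta1984, Ch. III §2 p.77] -/
theorem fdiff_mul (μ : Fin d) (φ u : Zd d → ℝ) (y : Zd d) :
    fdiff μ (fun x => φ x * u x) y = φ (y + unitVec μ) * fdiff μ u y + fdiff μ φ y * u y := by
  simp only [fdiff]; ring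

/-- `lop` is linear: differences. [folklore] [cite: Balaban1984PropagatorsII, (1.3) p.225] -/
theorem lop_sub (κ : ℝ) (u v : Zd d → ℝ) (y : Zd d) : lop κ (fun x => u x - v x) y = lop κ u y - lop κ v y := by
  have h : ∀ μ : Fin d, 2 * (u y - v y) - (u (y + unitVec μ) - v (y + unitVec μ)) - (u (y - unitVec μ) - v (y - unitVec μ)) =
      (2 * u y - u (y + unitVec μ) - u (y - unitVec μ)) - (2 * v y - v (y + unitVec μ) - v (y - unitVec μ)) := fun μ => by ring
  simp only [lop, h, Finset.sum_sub_distrib]; ring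

/-- `lop` is linear: scalars. [folklore] [cite: Balaban1984PropagatorsII, (1.3) p.225] -/
theorem lop_const_mul (κ c : ℝ) (u : Zd d → ℝ) (y : Zd d) : lop κ (fun x => c * u x) y = c * lop κ u y := by
  have h : ∀ μ : Fin d, 2 * (c * u y) - c * u (y + unitVec μ) - c * u (y - unitVec μ) =
      c * (2 * u y - u (y + unitVec μ) - u (y - unitVec μ)) := fun μ => by ring
  simp only [lop, h, ← Finset.mul_sum]; ring

/-- `dvg` is linear: scalars. [folklore] [cite: Balaban1985BackgroundPropagators, (3.8) p.392] -/
theorem dvg_const_mul (c : ℝ) (g : Zd d → Fin d → ℝ) (y : Zd d) : dvg (fun x μ => c * g x μ) y = c * dvg g y := by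
  have h : ∀ μ : Fin d, c * g (y - unitVec μ) μ - c * g y μ = c * (g (y - unitVec μ) μ - g y μ) := fun μ => by ring
  simp only [dvg, h, ← Finset.mul_sum]

/-- **Translation covariance of `lop`**: `(−Δ+κ)(u(· + v))(y) = ((−Δ+κ)u)(y + v)`. [folklore] [cite: Balaban1984PropagatorsII, (1.3) p.225] -/
theorem lop_translate (κ : ℝ) (u : Zd d → ℝ) (v y : Zd d) : lop κ (fun x => u (x + v)) y = lop κ u (y + v) := by
  simp only [lop, add_right_comm _ _ v, sub_add_eq_add_sub]

/-- **`∂_ν` commutes with `−Δ + κ`**: `(−Δ+κ)(∂_ν u) = ∂_ν((−Δ+κ)u)` pointwise. [folklore] [cite: Giaquinta1984, Ch. III §2 p.78] -/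
theorem lop_fdiff (κ : ℝ) (ν : Fin d) (u : Zd d → ℝ) (y : Zd d) : lop κ (fdiff ν u) y = fdiff ν (lop κ u) y := by
  have h1 : ∀ μ : Fin d, y + unitVec μ + unitVec ν = y + unitVec ν + unitVec μ := fun μ => add_right_comm _ _ _
  have h2 : ∀ μ : Fin d, y - unitVec μ + unitVec ν = y + unitVec ν - unitVec μ := fun μ => by abel
  simp only [lop, fdiff, h1, h2, Finset.sum_sub_distrib]
  ring_nf
  simp only [Finset.sum_sub_distrib]
  ring

/-- In particular a `κ`-harmonic function has `κ`-harmonic forward differences where both points lie in the harmonic region. [folklore]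
[cite: Giaquinta1984, Ch. III §2 p.78] -/
theorem lop_fdiff_eq_zero {κ : ℝ} {u : Zd d → ℝ} {S : Finset (Zd d)} (hu : ∀ y ∈ S, lop κ u y = 0) (ν : Fin d) {y : Zd d}
    (hy : y ∈ S) (hy' : y + unitVec ν ∈ S) : lop κ (fdiff ν u) y = 0 := by
  rw [lop_fdiff, fdiff, hu y hy, hu _ hy', sub_zero]

/-! ## §4 Summation by parts on `ℤ^d` -/

/-- **SUMMATION BY PARTS for `−Δ + κ`**: for a test function `φ` vanishing off `Q_{R−1}(z)` and any `u`,
`Σ_{y ∈ Q_R(z)} φ(y)·((−Δ+κ)u)(y) = Σ_{y ∈ Q_R(z)} Σ_μ ∂_μφ(y)·∂_μu(y) + κ·Σ_{y ∈ Q_R(z)} φ(y)u(y)` (the discrete Dirichlet form; all bonds carrying a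
non-zero `∂_μφ` have both ends in `Q_R(z)`). [folklore] [cite: Giaquinta1984, Ch. III §2 (2.3) p.77] -/
theorem sum_mul_lop (κ : ℝ) (φ u : Zd d → ℝ) (z : Zd d) (R : ℤ) (hφ : ∀ y ∉ box z (R - 1), φ y = 0) :
    ∑ y ∈ box z R, φ y * lop κ u y = (∑ y ∈ box z R, ∑ μ, fdiff μ φ y * fdiff μ u y) + κ * ∑ y ∈ box z R, φ y * u y := by
  have key : ∀ μ : Fin d, ∑ y ∈ box z R, φ y * (u y - u (y - unitVec μ)) =
      ∑ y ∈ box z R, φ (y + unitVec μ) * (u (y + unitVec μ) - u y) := by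
    intro μ
    have h := sum_box_shift_of_support (F := fun y => φ y * (u y - u (y - unitVec μ))) (z := z) (R := R)
      (fun y hy => by simp only [hφ y hy, zero_mul]) (unitVec μ) (abs_unitVec_apply_le μ)
    simp only [add_sub_cancel_right] at h
    exact h.symm
  calc ∑ y ∈ box z R, φ y * lop κ u y
      = ∑ y ∈ box z R, ((∑ μ, (φ y * (u y - u (y + unitVec μ)) + φ y * (u y - u (y - unitVec μ)))) + κ * (φ y * u y)) := by
        refine Finset.sum_congr rfl fun y _ => ?_
        rw [lop_apply, mul_add, Finset.mul_sum]
        congr 1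
        · exact Finset.sum_congr rfl fun μ _ => by ring
        · ring
    _ = (∑ μ, ((∑ y ∈ box z R, φ y * (u y - u (y + unitVec μ))) + ∑ y ∈ box z R, φ y * (u y - u (y - unitVec μ)))) +
          κ * ∑ y ∈ box z R, φ y * u y := by
        rw [Finset.sum_add_distrib, Finset.sum_comm, ← Finset.mul_sum]
        congr 1
        exact Finset.sum_congr rfl fun μ _ => Finset.sum_add_distrib
    _ = (∑ μ, ∑ y ∈ box z R, fdiff μ φ y * fdiff μ u y) + κ * ∑ y ∈ box z R, φ y * u y := by
        congr 1
        refine Finset.sum_congr rfl fun μ _ => ?_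
        rw [key μ, ← Finset.sum_add_distrib]
        refine Finset.sum_congr rfl fun y _ => ?_
        simp only [fdiff]; ring
    _ = (∑ y ∈ box z R, ∑ μ, fdiff μ φ y * fdiff μ u y) + κ * ∑ y ∈ box z R, φ y * u y := by rw [Finset.sum_comm]

/-- **SUMMATION BY PARTS for the divergence**: for `φ` vanishing off `Q_{R−1}(z)`, `Σ_{y ∈ Q_R(z)} φ(y)·(∂*g)(y) = Σ_{y ∈ Q_R(z)} Σ_μ ∂_μφ(y)·g(y, μ)`
(`∂*` is the adjoint of the forward gradient). [folklore] [cite: Balaban1985BackgroundPropagators, (3.8) p.392] -/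
theorem sum_mul_dvg (φ : Zd d → ℝ) (g : Zd d → Fin d → ℝ) (z : Zd d) (R : ℤ) (hφ : ∀ y ∉ box z (R - 1), φ y = 0) :
    ∑ y ∈ box z R, φ y * dvg g y = ∑ y ∈ box z R, ∑ μ, fdiff μ φ y * g y μ := by
  have key : ∀ μ : Fin d, ∑ y ∈ box z R, φ y * g (y - unitVec μ) μ = ∑ y ∈ box z R, φ (y + unitVec μ) * g y μ := by
    intro μ
    have h := sum_box_shift_of_support (F := fun y => φ y * g (y - unitVec μ) μ) (z := z) (R := R)
      (fun y hy => by simp only [hφ y hy, zero_mul]) (unitVec μ) (abs_unitVec_apply_le μ)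
    simp only [add_sub_cancel_right] at h
    exact h.symm
  calc ∑ y ∈ box z R, φ y * dvg g y
      = ∑ y ∈ box z R, ∑ μ, (φ y * g (y - unitVec μ) μ - φ y * g y μ) := by
        refine Finset.sum_congr rfl fun y _ => ?_
        rw [dvg_apply, Finset.mul_sum]
        exact Finset.sum_congr rfl fun μ _ => by ring
    _ = ∑ μ, ((∑ y ∈ box z R, φ y * g (y - unitVec μ) μ) - ∑ y ∈ box z R, φ y * g y μ) := by
        rw [Finset.sum_comm]
        exact Finset.sum_congr rfl fun μ _ => Finset.sum_sub_distrib _ _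
    _ = ∑ μ, ∑ y ∈ box z R, fdiff μ φ y * g y μ := by
        refine Finset.sum_congr rfl fun μ _ => ?_
        rw [key μ, ← Finset.sum_sub_distrib]
        refine Finset.sum_congr rfl fun y _ => ?_
        simp only [fdiff]; ring
    _ = ∑ y ∈ box z R, ∑ μ, fdiff μ φ y * g y μ := Finset.sum_comm

/-- **The energy identity**: for `w` vanishing off `Q_{R−1}(z)`, `Σ_{Q_R(z)} w·((−Δ+κ)w) = gradSq w (Q_R(z)) + κ·Σ_{Q_R(z)} w²`.
[folklore] [cite: Giaquinta1984, Ch. III §2 (2.3) p.77] -/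
theorem sum_mul_lop_self (κ : ℝ) (w : Zd d → ℝ) (z : Zd d) (R : ℤ) (hw : ∀ y ∉ box z (R - 1), w y = 0) :
    ∑ y ∈ box z R, w y * lop κ w y = gradSq w (box z R) + κ * ∑ y ∈ box z R, w y ^ 2 := by
  rw [sum_mul_lop κ w w z R hw, gradSq_def]
  congr 1
  · exact Finset.sum_congr rfl fun y _ => Finset.sum_congr rfl fun μ _ => by ring
  · congr 1; exact Finset.sum_congr rfl fun y _ => by ring

end Literature.MathematicalPhysics.QuantumFieldTheory.Balaban1983to89.B4Eq19LatticeOperators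

end
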